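import Summits.Ventures.LatticeQCDFlow.TrivializingMaps.BlaschkeCoefficient
import Summits.Ventures.LatticeQCDFlow.TrivializingMaps.FisherZerosExist

/-!
HONEST FRAMING: exact (Metropolis-corrected) sampling algorithms for lattice gauge theory; figures
of merit are autocorrelation/cost numbers at stated couplings and volumes; no continuum-physics
claim.

# FisherZerosCarryVariance — the zeros of the Laplace transform inside `|z| < R`, weighted by
# `1/|u|²`, carry the variance: `Var X ≤ 4|b|/R + ∑_u m_u/|u|²` (lean-2 GEN-7, ours)

Venture-side (OURS).  Cell `lqcd-flow` (pub-lqcd), unit `pub-lqcd-lean-2-g7`, 2026-08-22.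

Docking of the pure `BlaschkeCoefficient.re_deriv_logDeriv_le` to the complex MGF
`Z(z) = ∫ e^{zX} dμ` of a bounded random variable (`|X| ≤ b` a.e., probability measure):
`(Z′/Z)′(0) = Var X` (tree `deriv_logDeriv_complexMGF_zero`) and `|Z| ≤ e^{|b|R}` on `|z| = R`, so
for every Blaschke factorisation of `Z` on `|z| ≤ R` — zeros `0 < |u| < R` with multiplicities `m_u`
divided out, the quotient `h` zero-free on the open disc —

* **`variance_le_of_blaschkeFactorization`**: `Var X ≤ 4|b|/R + ∑_{u} m_u/|u|²`.

Consequences (value-free, proved here only in the displayed inequality form): if `Z` is zero-free on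
`|z| < ρ` then every `|u| ≥ ρ` and `∑ m_u/|u|² ≤ N/ρ²` with `N = ∑ m_u` the number of zeros in the open
disc, so `N ≥ ρ²·(Var X − 4|b|/R)` (`card_zeros_ge_of_blaschkeFactorization`).  For the `SU(n)` Wilson
action in volume `L` (`b = 2n·#plaq` uncentred, `Var = m₂(n)·#plaq`, THEOREM-A zero-free radius `ρ`
uniform in `L`) this reads: the number of Fisher zeros of `Z_L` in `|s| < R` is at least
`ρ²·#plaq·(m₂(n) − 8n/R)` — EXTENSIVE IN THE VOLUME for `R > 8n/m₂(n)`.  The existence of the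
Blaschke factorisation with ALL zeros of the open disc (Mathlib `MeromorphicOn.extract_zeros_poles` /
`divisor`) is NOT proved in this file; it is the hypothesis `hfh`/`hh0`, to be discharged next.

NOT CLAIMED: the factorisation itself; any count for any concrete volume; cost / autocorrelation /
continuum statements.
-/

noncomputable section

open MeasureTheory ProbabilityTheory Complex Metric Set Filter Topology
open scoped ComplexConjugate

namespace Summit.Ventures.LatticeQCDFlow.TrivializingMaps

variable {Ω : Type*} [MeasurableSpace Ω] {μ : Measure Ω} [IsProbabilityMeasure μ]
  {X : Ω → ℝ} {b : ℝ}

/-- **The zeros inside `|z| < R` carry the variance.**  `|X| ≤ b` a.e. under a probability measure,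
`Z = complexMGF X μ`; a Blaschke factorisation `Z·∏(R² − ū z)^{m_u} = h·∏(R(z − u))^{m_u}` on
`|z| ≤ R` (`0 < |u| < R` for `u ∈ T`) with `h` holomorphic on the closed disc and zero-free on the
open disc.  Then `Var X ≤ 4|b|/R + ∑_{u ∈ T} m_u/|u|²`. [ours] -/
theorem variance_le_of_blaschkeFactorization (hm : AEMeasurable X μ) (hb : ∀ᵐ ω ∂μ, |X ω| ≤ b)
    {R : ℝ} (hR : 0 < R) (T : Finset ℂ) (m : ℂ → ℕ) (hT : ∀ u ∈ T, u ≠ 0 ∧ ‖u‖ < R)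
    {h : ℂ → ℂ} (hh : DifferentiableOn ℂ h (closedBall 0 R)) (hh0 : ∀ z ∈ ball (0 : ℂ) R, h z ≠ 0)
    (hfh : ∀ z ∈ closedBall (0 : ℂ) R,
      complexMGF X μ z * ∏ u ∈ T, ((R : ℂ) ^ 2 - conj u * z) ^ m u =
        h z * ∏ u ∈ T, ((R : ℂ) * (z - u)) ^ m u) :
    variance X μ ≤ 4 * |b| / R + ∑ u ∈ T, (m u : ℝ) / ‖u‖ ^ 2 := by
  set Z := complexMGF X μ with hZdef
  have hZd : Differentiable ℂ Z := ZeroPinching.differentiable_complexMGF_of_abs_le hm hb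
  have hZ0 : Z 0 = 1 := by
    rw [hZdef, show (0 : ℂ) = ((0 : ℝ) : ℂ) from Complex.ofReal_zero.symm, complexMGF_ofReal,
      mgf_zero]
    simp
  -- growth on the circle: `‖Z z‖ ≤ e^{|b| R}`
  have hA : ∀ z ∈ sphere (0 : ℂ) R, ‖Z z‖ ≤ Real.exp (|b| * R) := fun z hz => by
    have hzR : ‖z‖ = R := by simpa using hz
    refine (norm_complexMGF_le_mgf).trans ((ZeroPinching.mgf_le_exp_of_abs_le hm hb z.re).trans ?_)
    refine Real.exp_le_exp.mpr ?_
    calc |z.re| * b ≤ |z.re| * |b| := mul_le_mul_of_nonneg_left (le_abs_self b) (abs_nonneg _)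
      _ ≤ ‖z‖ * |b| := mul_le_mul_of_nonneg_right (abs_re_le_norm z) (abs_nonneg b)
      _ = |b| * R := by rw [hzR, mul_comm]
  have hcore := Blaschke.re_deriv_logDeriv_le (f := Z) hR T m hT (hZd.differentiableOn) hh hh0 hfh
    hZ0 hA
  -- `(Z′/Z)′(0) = Var X`
  have hG0 : deriv (logDeriv Z) 0 = ((variance X μ : ℝ) : ℂ) := by
    have : logDeriv Z = fun w => deriv Z w / Z w := funext fun w => logDeriv_apply Z w
    rw [this]
    exact deriv_logDeriv_complexMGF_zero hm hb
  rw [hG0, Complex.ofReal_re] at hcore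
  calc variance X μ ≤ 4 * (|b| * R) / R ^ 2 + ∑ u ∈ T, (m u : ℝ) / ‖u‖ ^ 2 := hcore
    _ = 4 * |b| / R + ∑ u ∈ T, (m u : ℝ) / ‖u‖ ^ 2 := by
        congr 1
        field_simp

/-- **Counting form.**  In the same setting, if moreover every divided-out zero has `|u| ≥ ρ > 0`
(e.g. `Z` is zero-free on `|z| < ρ`), then the number of divided-out zeros with multiplicity satisfies
`ρ²·(Var X − 4|b|/R) ≤ ∑_{u ∈ T} m_u`. [ours] -/
theorem card_zeros_ge_of_blaschkeFactorization (hm : AEMeasurable X μ) (hb : ∀ᵐ ω ∂μ, |X ω| ≤ b)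
    {R ρ : ℝ} (hR : 0 < R) (hρ : 0 < ρ) (T : Finset ℂ) (m : ℂ → ℕ)
    (hT : ∀ u ∈ T, u ≠ 0 ∧ ‖u‖ < R) (hTρ : ∀ u ∈ T, ρ ≤ ‖u‖)
    {h : ℂ → ℂ} (hh : DifferentiableOn ℂ h (closedBall 0 R)) (hh0 : ∀ z ∈ ball (0 : ℂ) R, h z ≠ 0)
    (hfh : ∀ z ∈ closedBall (0 : ℂ) R,
      complexMGF X μ z * ∏ u ∈ T, ((R : ℂ) ^ 2 - conj u * z) ^ m u =
        h z * ∏ u ∈ T, ((R : ℂ) * (z - u)) ^ m u) :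
    ρ ^ 2 * (variance X μ - 4 * |b| / R) ≤ ∑ u ∈ T, (m u : ℝ) := by
  have hv := variance_le_of_blaschkeFactorization hm hb hR T m hT hh hh0 hfh
  have hsum : ∑ u ∈ T, (m u : ℝ) / ‖u‖ ^ 2 ≤ ∑ u ∈ T, (m u : ℝ) / ρ ^ 2 :=
    Finset.sum_le_sum fun u hu =>
      div_le_div_of_nonneg_left (Nat.cast_nonneg _) (by positivity)
        (pow_le_pow_left₀ hρ.le (hTρ u hu) 2)
  rw [← Finset.sum_div] at hsum
  have hρ2 : 0 < ρ ^ 2 := by positivity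
  have : variance X μ - 4 * |b| / R ≤ (∑ u ∈ T, (m u : ℝ)) / ρ ^ 2 := by linarith
  calc ρ ^ 2 * (variance X μ - 4 * |b| / R) ≤ ρ ^ 2 * ((∑ u ∈ T, (m u : ℝ)) / ρ ^ 2) :=
        mul_le_mul_of_nonneg_left this hρ2.le
    _ = ∑ u ∈ T, (m u : ℝ) := by field_simp

end Summit.Ventures.LatticeQCDFlow.TrivializingMaps

end
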